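import Summits.CriticalPhenomena.PercolationContinuityZ3.Theorems.PercNearOneGluingNoHeavyQuantIndepBlobPairRaise
import HarnessLib

/-!
# QUANT lane R8, blob lemma (U): coupling identities for two blobs with a common gate (merge and anti-merge)

builds on p205010 (kernel theorem, internal audit signed; external expert review pending)

Support file (`--supports stmt-CriticalPhenomena-4575`), QUANT lane seat prim-quant-census-1 (gen 12); memo
`run/shared/lean/prim/quant/prim-quant-census-1/U-REDUCTIONS-G12.md` §2 (reductions R3, R4).  Theorems only; no sorries; standard axioms.

Two blobs `x₀ ≠ x₁` with the same gate `t` (sizes `a x₀, a x₁`), the other blobs `R` arbitrary; `A(c) = P(y ≤ c + a(R-configuration))`.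
The independent pair is a mixture of the COMONOTONE coupling (both open with probability `t`: one merged blob of size `a x₀ + a x₁`, gate `t`)
and the ANTI-coupling (exactly one open, each with probability `t`), with weights `t` and `1 − t`:
* `tail_merged_eq`, `tail_doubled_eq` — the tails of the merged system (`x₀ ↦` size `a x₀ + a x₁`, `x₁ ↦` gate `0`) and of the
  doubled-gate system (`x₀ ↦` gate `2t`, `x₁ ↦` gate `0`) in terms of `A`.
* `tail_sub_tail_merged` (R4) — `P(y ≤ W) − P_merged(y ≤ W) = t(1−t)·[A(a x₀) + A(a x₁) − A(a x₀ + a x₁) − A(0)]`; the bracket is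
  `P(R ∈ [y − a x₁, y − 1]) − P(R ∈ [y − a x₀ − a x₁, y − a x₀ − 1])` (the MERGE bracket `B` of the memo), so merging two equal-gate blobs
  can only lower the tail when `B ≥ 0`; `tail_ge_tail_merged`.
* `tail_eq_mixture_of_equal_blocks` (R3) — for EQUAL SIZES `a x₀ = a x₁`:
  `P(y ≤ W) = (1 − t)·P_doubled(y ≤ W) + t·P_merged(y ≤ W)`, hence `tail_ge_of_equal_blocks`: lower bounds `t ≤ P_doubled`, `t ≤ P_merged`
  give `t ≤ P(y ≤ W)` — an exact reduction of (U) removing one blob (both reduced systems have the same mean).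
[this work]
-/

namespace Summit.CriticalPhenomena.PercolationContinuityZ3.Theorems

namespace Quant

namespace IndepBlob

open Finset

variable {κ : Type*} [Fintype κ] [DecidableEq κ]

/-- The tail of the MERGED system (`x₀` gets size `a x₀ + a x₁` and keeps its gate `t`, `x₁` gets gate `0`):
`P_merged(y ≤ W) = t·A(a x₀ + a x₁) + (1 − t)·A(0)`. [this work] -/
theorem tail_merged_eq (p : κ → ℝ) (a : κ → ℕ) {x₀ x₁ : κ} (hx : x₀ ≠ x₁) (y : ℕ) :
    ∑ s ∈ (Finset.univ : Finset (Finset κ)).filter (fun s => y ≤ ∑ k ∈ s, Function.update a x₀ (a x₀ + a x₁) k),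
        (∏ k, if k ∈ s then Function.update p x₁ 0 k else 1 - Function.update p x₁ 0 k) =
      p x₀ * ∑ t ∈ (((Finset.univ.erase x₀).erase x₁).powerset).filter (fun t => y ≤ a x₀ + a x₁ + ∑ k ∈ t, a k),
          (∏ k ∈ (Finset.univ.erase x₀).erase x₁, if k ∈ t then p k else 1 - p k) +
        (1 - p x₀) * ∑ t ∈ (((Finset.univ.erase x₀).erase x₁).powerset).filter (fun t => y ≤ ∑ k ∈ t, a k),
          (∏ k ∈ (Finset.univ.erase x₀).erase x₁, if k ∈ t then p k else 1 - p k) := by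
  rw [tail_eq_two_gate_affine (Function.update p x₁ 0) (Function.update a x₀ (a x₀ + a x₁)) hx y,
    Function.update_self, Function.update_of_ne hx, Function.update_self, Function.update_of_ne hx.symm]
  have hw : ∀ s : Finset κ, (∏ k ∈ (Finset.univ.erase x₀).erase x₁,
      if k ∈ s then Function.update p x₁ 0 k else 1 - Function.update p x₁ 0 k) =
      ∏ k ∈ (Finset.univ.erase x₀).erase x₁, (if k ∈ s then p k else 1 - p k) := by
    intro s
    refine Finset.prod_congr rfl fun k hk => ?_
    rw [Function.update_of_ne (Finset.mem_erase.1 hk).1]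
  have ha : ∀ s : Finset κ, s ∈ ((Finset.univ.erase x₀).erase x₁).powerset →
      ∑ k ∈ s, Function.update a x₀ (a x₀ + a x₁) k = ∑ k ∈ s, a k := by
    intro s hs
    refine Finset.sum_congr rfl fun k hk => ?_
    have hk' := Finset.mem_powerset.1 hs hk
    rw [Function.update_of_ne (Finset.mem_erase.1 (Finset.mem_erase.1 hk').2).1]
  have hf : ∀ c : ℕ, ((((Finset.univ.erase x₀).erase x₁).powerset).filter
      (fun t => y ≤ c + ∑ k ∈ t, Function.update a x₀ (a x₀ + a x₁) k)) =
      (((Finset.univ.erase x₀).erase x₁).powerset).filter (fun t => y ≤ c + ∑ k ∈ t, a k) := by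
    intro c
    exact Finset.filter_congr fun s hs => by rw [ha s hs]
  have hf0 : ((((Finset.univ.erase x₀).erase x₁).powerset).filter
      (fun t => y ≤ ∑ k ∈ t, Function.update a x₀ (a x₀ + a x₁) k)) =
      (((Finset.univ.erase x₀).erase x₁).powerset).filter (fun t => y ≤ ∑ k ∈ t, a k) := by
    exact Finset.filter_congr fun s hs => by rw [ha s hs]
  simp_rw [hw]
  rw [hf, hf, hf0]
  ring

/-- The tail of the DOUBLED-GATE system (`x₀` gets gate `2·p x₀`, `x₁` gets gate `0`, sizes unchanged):
`P_doubled(y ≤ W) = 2t·A(a x₀) + (1 − 2t)·A(0)`. [this work] -/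
theorem tail_doubled_eq (p : κ → ℝ) (a : κ → ℕ) {x₀ x₁ : κ} (hx : x₀ ≠ x₁) (y : ℕ) :
    ∑ s ∈ (Finset.univ : Finset (Finset κ)).filter (fun s => y ≤ ∑ k ∈ s, a k),
        (∏ k, if k ∈ s then Function.update (Function.update p x₀ (2 * p x₀)) x₁ 0 k
          else 1 - Function.update (Function.update p x₀ (2 * p x₀)) x₁ 0 k) =
      2 * p x₀ * ∑ t ∈ (((Finset.univ.erase x₀).erase x₁).powerset).filter (fun t => y ≤ a x₀ + ∑ k ∈ t, a k),
          (∏ k ∈ (Finset.univ.erase x₀).erase x₁, if k ∈ t then p k else 1 - p k) +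
        (1 - 2 * p x₀) * ∑ t ∈ (((Finset.univ.erase x₀).erase x₁).powerset).filter (fun t => y ≤ ∑ k ∈ t, a k),
          (∏ k ∈ (Finset.univ.erase x₀).erase x₁, if k ∈ t then p k else 1 - p k) := by
  rw [tail_eq_two_gate_affine (Function.update (Function.update p x₀ (2 * p x₀)) x₁ 0) a hx y,
    Function.update_of_ne hx, Function.update_self, Function.update_self]
  have hw : ∀ s : Finset κ, (∏ k ∈ (Finset.univ.erase x₀).erase x₁,
      if k ∈ s then Function.update (Function.update p x₀ (2 * p x₀)) x₁ 0 k
        else 1 - Function.update (Function.update p x₀ (2 * p x₀)) x₁ 0 k) =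
      ∏ k ∈ (Finset.univ.erase x₀).erase x₁, (if k ∈ s then p k else 1 - p k) := by
    intro s
    refine Finset.prod_congr rfl fun k hk => ?_
    have hk1 : k ≠ x₁ := (Finset.mem_erase.1 hk).1
    have hk0 : k ≠ x₀ := (Finset.mem_erase.1 (Finset.mem_erase.1 hk).2).1
    rw [Function.update_of_ne hk1, Function.update_of_ne hk0]
  simp_rw [hw]
  ring

/-- **R4 (merge identity).**  If `p x₀ = p x₁ = t` then
`P(y ≤ W) − P_merged(y ≤ W) = t(1−t)·[A(a x₀) + A(a x₁) − A(a x₀ + a x₁) − A(0)]`. [this work] -/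
theorem tail_sub_tail_merged (p : κ → ℝ) (a : κ → ℕ) {x₀ x₁ : κ} (hx : x₀ ≠ x₁) (heq : p x₁ = p x₀) (y : ℕ) :
    ∑ s ∈ (Finset.univ : Finset (Finset κ)).filter (fun s => y ≤ ∑ k ∈ s, a k), (∏ k, if k ∈ s then p k else 1 - p k) -
      ∑ s ∈ (Finset.univ : Finset (Finset κ)).filter (fun s => y ≤ ∑ k ∈ s, Function.update a x₀ (a x₀ + a x₁) k),
        (∏ k, if k ∈ s then Function.update p x₁ 0 k else 1 - Function.update p x₁ 0 k) =
      p x₀ * (1 - p x₀) *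
        (∑ t ∈ (((Finset.univ.erase x₀).erase x₁).powerset).filter (fun t => y ≤ a x₀ + ∑ k ∈ t, a k),
            (∏ k ∈ (Finset.univ.erase x₀).erase x₁, if k ∈ t then p k else 1 - p k) +
          ∑ t ∈ (((Finset.univ.erase x₀).erase x₁).powerset).filter (fun t => y ≤ a x₁ + ∑ k ∈ t, a k),
            (∏ k ∈ (Finset.univ.erase x₀).erase x₁, if k ∈ t then p k else 1 - p k) -
          ∑ t ∈ (((Finset.univ.erase x₀).erase x₁).powerset).filter (fun t => y ≤ a x₀ + a x₁ + ∑ k ∈ t, a k),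
            (∏ k ∈ (Finset.univ.erase x₀).erase x₁, if k ∈ t then p k else 1 - p k) -
          ∑ t ∈ (((Finset.univ.erase x₀).erase x₁).powerset).filter (fun t => y ≤ ∑ k ∈ t, a k),
            (∏ k ∈ (Finset.univ.erase x₀).erase x₁, if k ∈ t then p k else 1 - p k)) := by
  rw [tail_eq_two_gate_affine p a hx y, tail_merged_eq p a hx y, heq]
  ring

/-- **Merging two equal-gate blobs lowers the tail when the merge bracket is nonnegative** (R4): with `p x₀ = p x₁ ∈ [0,1]` and
`A(a x₀ + a x₁) + A(0) ≤ A(a x₀) + A(a x₁)`, `P_merged(y ≤ W) ≤ P(y ≤ W)`. [this work] -/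
theorem tail_ge_tail_merged (p : κ → ℝ) (a : κ → ℕ) (hp0 : ∀ k, 0 ≤ p k) (hp1 : ∀ k, p k ≤ 1) {x₀ x₁ : κ} (hx : x₀ ≠ x₁)
    (heq : p x₁ = p x₀) (y : ℕ)
    (hB : ∑ t ∈ (((Finset.univ.erase x₀).erase x₁).powerset).filter (fun t => y ≤ a x₀ + a x₁ + ∑ k ∈ t, a k),
            (∏ k ∈ (Finset.univ.erase x₀).erase x₁, if k ∈ t then p k else 1 - p k) +
          ∑ t ∈ (((Finset.univ.erase x₀).erase x₁).powerset).filter (fun t => y ≤ ∑ k ∈ t, a k),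
            (∏ k ∈ (Finset.univ.erase x₀).erase x₁, if k ∈ t then p k else 1 - p k) ≤
        ∑ t ∈ (((Finset.univ.erase x₀).erase x₁).powerset).filter (fun t => y ≤ a x₀ + ∑ k ∈ t, a k),
            (∏ k ∈ (Finset.univ.erase x₀).erase x₁, if k ∈ t then p k else 1 - p k) +
          ∑ t ∈ (((Finset.univ.erase x₀).erase x₁).powerset).filter (fun t => y ≤ a x₁ + ∑ k ∈ t, a k),
            (∏ k ∈ (Finset.univ.erase x₀).erase x₁, if k ∈ t then p k else 1 - p k)) :
    ∑ s ∈ (Finset.univ : Finset (Finset κ)).filter (fun s => y ≤ ∑ k ∈ s, Function.update a x₀ (a x₀ + a x₁) k),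
        (∏ k, if k ∈ s then Function.update p x₁ 0 k else 1 - Function.update p x₁ 0 k) ≤
      ∑ s ∈ (Finset.univ : Finset (Finset κ)).filter (fun s => y ≤ ∑ k ∈ s, a k), (∏ k, if k ∈ s then p k else 1 - p k) := by
  have h := tail_sub_tail_merged p a hx heq y
  have ht : 0 ≤ p x₀ * (1 - p x₀) := mul_nonneg (hp0 x₀) (by linarith [hp1 x₀])
  nlinarith [h, ht, hB]

/-- **R3 (mixture identity for two equal blobs).**  If `p x₀ = p x₁ = t` and `a x₀ = a x₁` then
`P(y ≤ W) = (1 − t)·P_doubled(y ≤ W) + t·P_merged(y ≤ W)`: the independent coupling of two equal blobs is the mixture of the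
anti-coupling (one blob of gate `2t`) and the comonotone coupling (one blob of double size), with weights `1 − t` and `t`. [this work] -/
theorem tail_eq_mixture_of_equal_blocks (p : κ → ℝ) (a : κ → ℕ) {x₀ x₁ : κ} (hx : x₀ ≠ x₁) (heq : p x₁ = p x₀)
    (ha : a x₁ = a x₀) (y : ℕ) :
    ∑ s ∈ (Finset.univ : Finset (Finset κ)).filter (fun s => y ≤ ∑ k ∈ s, a k), (∏ k, if k ∈ s then p k else 1 - p k) =
      (1 - p x₀) * ∑ s ∈ (Finset.univ : Finset (Finset κ)).filter (fun s => y ≤ ∑ k ∈ s, a k),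
          (∏ k, if k ∈ s then Function.update (Function.update p x₀ (2 * p x₀)) x₁ 0 k
            else 1 - Function.update (Function.update p x₀ (2 * p x₀)) x₁ 0 k) +
        p x₀ * ∑ s ∈ (Finset.univ : Finset (Finset κ)).filter (fun s => y ≤ ∑ k ∈ s, Function.update a x₀ (a x₀ + a x₁) k),
          (∏ k, if k ∈ s then Function.update p x₁ 0 k else 1 - Function.update p x₁ 0 k) := by
  rw [tail_eq_two_gate_affine p a hx y, tail_merged_eq p a hx y, tail_doubled_eq p a hx y, heq, ha]
  ring

/-- **(U)-reduction by R3.**  Two blobs with the same gate `t = p x₀ = p x₁` and the same size: lower bounds `t ≤ P_doubled(y ≤ W)` and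
`t ≤ P_merged(y ≤ W)` for the two one-blob-fewer systems give `t ≤ P(y ≤ W)` (for `0 ≤ t ≤ 1`). [this work] -/
theorem tail_ge_of_equal_blocks (p : κ → ℝ) (a : κ → ℕ) {x₀ x₁ : κ} (hx : x₀ ≠ x₁) (heq : p x₁ = p x₀)
    (ha : a x₁ = a x₀) (ht0 : 0 ≤ p x₀) (ht1 : p x₀ ≤ 1) (y : ℕ)
    (h1 : p x₀ ≤ ∑ s ∈ (Finset.univ : Finset (Finset κ)).filter (fun s => y ≤ ∑ k ∈ s, a k),
          (∏ k, if k ∈ s then Function.update (Function.update p x₀ (2 * p x₀)) x₁ 0 k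
            else 1 - Function.update (Function.update p x₀ (2 * p x₀)) x₁ 0 k))
    (h2 : p x₀ ≤ ∑ s ∈ (Finset.univ : Finset (Finset κ)).filter (fun s => y ≤ ∑ k ∈ s, Function.update a x₀ (a x₀ + a x₁) k),
          (∏ k, if k ∈ s then Function.update p x₁ 0 k else 1 - Function.update p x₁ 0 k)) :
    p x₀ ≤ ∑ s ∈ (Finset.univ : Finset (Finset κ)).filter (fun s => y ≤ ∑ k ∈ s, a k), (∏ k, if k ∈ s then p k else 1 - p k) := by
  rw [tail_eq_mixture_of_equal_blocks p a hx heq ha y]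
  nlinarith [h1, h2, ht0, ht1]

end IndepBlob

end Quant

end Summit.CriticalPhenomena.PercolationContinuityZ3.Theorems
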